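import Summits.QuantumFields.YangMills.Theorems.LocalInsertionSublevelDoublingDefs
import Summits.QuantumFields.YangMills.Theorems.LangevinControlUVFemtoCurvatureTwoPointCDoublingPlaquette
import HarnessLib

/-!
# Sublevel doubling of Wilson's action on `(ℤ/L)^d`, every `d` — plaquette and action formulas in the chart

Crux `HistoryTailL` (stmt-QuantumFields-19936), level-0 lane (T4) «uniform doubling», row (T4-SUB), file 3: the `{d : ℕ}`-generic port
(literal `4 ↦ d`, proofs verbatim) of `Theorems/LangevinControlUVFemtoCurvatureTwoPointCDoublingPlaquette.lean` (route `LangevinControlUV`,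
crux `FemtoCurvatureTwoPointC`, line `Sketch` v7, file P2); its d-FREE lemmas (`rho_inv_mul`, `rho_mul_inv`, `rho_matrix_inv`, `isUnit_rho`,
`conjTranspose_rho`, `rho_inv_conj_conj`, `exp_lieIso_adFib`, `exp_neg_lieIso_adFib`, `expChart_adFib`, `rho_expChart_inv`,
`sub_re_trace_eq_norm_sq`, `re_trace_conjTranspose_conj_mul`) are IMPORTED from that file, not copied. For the exponential chart
`cfg τ A (x,i) = expChart (A(x,i)) · τ(x,i)` at a configuration `τ` on `(ℤ/L)^d` (`…SublevelDoublingDefs`):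

* `rho_cfg`, `cfg_zero`;
* `rho_plaquetteHolonomy_cfg` — at a plaquette where `τ` is flat, `ρ(U_p(cfg τ A)) = e^{a₁} e^{a₂} e^{−a₃} e^{−a₄}` with
  `a₁ = M A(x,i)`, `a₂ = M(Ad τ(x,i) A(x+e_i,j))`, `a₃ = M(Ad τ(x,j) A(x+e_j,i))`, `a₄ = M A(x,j)` (`M = lieIso r.ρ`);
* `wilsonAction_eq_sum_norm_sq` — `S(U) = Σ_p ‖1 − ρ U_p‖²/2` for a unitary representation, on `(ℤ/L)^d`;
* `gaugeTransform_cfg_of_stab` — `k · cfg τ A = cfg τ (rot k A)` for `k` in the stabiliser of `τ`; `gaugeTransform_gaugeExp_of_mem_zeroModes`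
  — `gaugeExp ζ` stabilises `τ` for a zero mode `ζ`; `rho_gaugeTransform_cfg`;
* `sum_re_trace_conjTranspose_mul_dOne` — the CROSS-TERM IDENTITY: for a covariantly constant matrix field `α`
  (`α(x) = ρτ(x,i) α(x+e_i) ρτ(x,i)⁻¹`), `Σ_x Re tr(α(x)ᴴ · M((d¹B)_{ij}(x))) = 0` for every 1-form `B`.
Rung R3 (continuum SU(2) YM₃ on T³) — not infinite volume, not a mass gap, not Clay. Everything here is proved; no definitions.
-/

set_option autoImplicit false

noncomputable section

open scoped Matrix Matrix.Norms.Frobenius InnerProductSpace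
open NormedSpace
open Literature.MathematicalPhysics.QuantumLattice Literature.MathematicalPhysics.QuantumFieldTheory
open Summit.QuantumFields.YangMills.Theorems.FreeEnergyLogCoefficient
open Summit.QuantumFields.YangMills.Theorems.FemtoCurvatureTwoPointC (stub_expCommutatorBracket)
open Summit.QuantumFields.YangMills.Theorems.FemtoCurvatureTwoPointC.Doubling (Fib adFib lieIso_adFib adFib_mul adFib_one
  adFib_inv_apply adFib_apply_inv inner_adFib rho_inv_mul rho_mul_inv rho_matrix_inv isUnit_rho conjTranspose_rho
  rho_inv_conj_conj exp_lieIso_adFib exp_neg_lieIso_adFib expChart_adFib rho_expChart_inv sub_re_trace_eq_norm_sq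
  re_trace_conjTranspose_conj_mul)

namespace Summit.QuantumFields.YangMills.Theorems.LocalInsertion.SublevelDoubling

variable {G : Type} [Group G] [TopologicalSpace G] [CompactSpace G] (r : LatticeRep G) {d L : ℕ}

/-! ### The chart in matrices -/

/-- `ρ (cfg τ A e) = exp (M (A e)) · ρ (τ e)`. -/
theorem rho_cfg (τ : GaugeConfig d L G) (A : OneForm r d L) (e : Edge d L) :
    r.ρ (cfg r τ A e) = exp (lieIso r.ρ (A e)) * r.ρ (τ e) := by
  rw [cfg, map_mul, rho_expChart r.ρ r.continuous]

/-- `cfg τ 0 = τ`. -/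
theorem cfg_zero (τ : GaugeConfig d L G) : cfg r τ (0 : OneForm r d L) = τ := by
  funext e
  rw [cfg, PiLp.zero_apply, expChart_zero r.ρ r.continuous r.injective, one_mul]

/-! ### The plaquette holonomy of a chart point at a flat plaquette -/

/-- **Plaquette formula.** If `τ` is flat at the plaquette `(x; i, j)`, then
`ρ (U_{x;ij}(cfg τ A)) = e^{a₁} e^{a₂} e^{−a₃} e^{−a₄}` with `a₁ = M A(x,i)`, `a₂ = M (Ad τ(x,i) A(x+e_i, j))`,
`a₃ = M (Ad τ(x,j) A(x+e_j, i))`, `a₄ = M A(x,j)`. -/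
theorem rho_plaquetteHolonomy_cfg {τ : GaugeConfig d L G} {x : Site d L} {i j : Fin d}
    (hτ : plaquetteHolonomy τ x i j = 1) (A : OneForm r d L) :
    r.ρ (plaquetteHolonomy (cfg r τ A) x i j) =
      exp (lieIso r.ρ (A (x, i))) * exp (lieIso r.ρ (adFib r (τ (x, i)) (A (x.shift i, j)))) *
        exp (-lieIso r.ρ (adFib r (τ (x, j)) (A (x.shift j, i)))) * exp (-lieIso r.ρ (A (x, j))) := by
  -- names
  set t₁ := τ (x, i) with ht₁
  set t₂ := τ (x.shift i, j) with ht₂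
  set t₃ := τ (x.shift j, i) with ht₃
  set t₄ := τ (x, j) with ht₄
  have hflat : t₁ * t₂ * t₃⁻¹ = t₄ := by
    have h : t₁ * t₂ * t₃⁻¹ * t₄⁻¹ = 1 := hτ
    calc t₁ * t₂ * t₃⁻¹ = t₁ * t₂ * t₃⁻¹ * t₄⁻¹ * t₄ := by group
      _ = t₄ := by rw [h, one_mul]
  have hexp : ∀ a : Fib r, r.ρ (expChart r.ρ a) = exp (lieIso r.ρ a) := fun a => rho_expChart r.ρ r.continuous a
  -- the holonomy as a group word
  have hword : plaquetteHolonomy (cfg r τ A) x i j =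
      expChart r.ρ (A (x, i)) * (t₁ * expChart r.ρ (A (x.shift i, j)) * t₁⁻¹) *
        (t₄ * (expChart r.ρ (A (x.shift j, i)))⁻¹ * t₄⁻¹) * (expChart r.ρ (A (x, j)))⁻¹ := by
    simp only [plaquetteHolonomy, cfg]
    rw [← ht₁, ← ht₂, ← ht₃, ← ht₄, ← hflat]
    group
  have h2 : r.ρ (t₁ * expChart r.ρ (A (x.shift i, j)) * t₁⁻¹) = exp (lieIso r.ρ (adFib r t₁ (A (x.shift i, j)))) := by
    rw [map_mul, map_mul, hexp, exp_lieIso_adFib]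
  have h3 : r.ρ (t₄ * (expChart r.ρ (A (x.shift j, i)))⁻¹ * t₄⁻¹) = exp (-lieIso r.ρ (adFib r t₄ (A (x.shift j, i)))) := by
    rw [map_mul, map_mul, rho_expChart_inv, exp_neg_lieIso_adFib]
  rw [hword, map_mul, map_mul, map_mul, hexp, h2, h3, rho_expChart_inv]

/-! ### The action as a sum of squared Frobenius distances -/

omit [CompactSpace G] in
/-- **The Wilson action is half the sum of the squared Frobenius distances of the plaquette holonomies to `1`.** -/
theorem wilsonAction_eq_sum_norm_sq [NeZero L] (U : GaugeConfig d L G) :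
    wilsonAction r.ρ U = ∑ p : Plaquette d L, ‖1 - r.ρ (plaquetteHolonomy U p.1 p.2.1.1 p.2.1.2)‖ ^ 2 / 2 := by
  unfold wilsonAction
  exact Finset.sum_congr rfl fun p _ => sub_re_trace_eq_norm_sq r _

/-! ### Gauge transformations in the chart -/

/-- **The stabiliser acts linearly in the chart**: if `k` fixes `τ`, then `k · cfg τ A = cfg τ (rot k A)`. -/
theorem gaugeTransform_cfg_of_stab [NeZero L] {τ : GaugeConfig d L G} {k : Site d L → G} (hk : gaugeTransform k τ = τ)
    (A : OneForm r d L) : gaugeTransform k (cfg r τ A) = cfg r τ (rot r k A) := by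
  funext e
  have hke : k e.1 * τ e * (k (e.1.shift e.2))⁻¹ = τ e := congrFun hk e
  show k e.1 * (expChart r.ρ (A e) * τ e) * (k (e.1.shift e.2))⁻¹ = expChart r.ρ (rot r k A e) * τ e
  rw [rot_apply, expChart_adFib]
  calc k e.1 * (expChart r.ρ (A e) * τ e) * (k (e.1.shift e.2))⁻¹
        = k e.1 * expChart r.ρ (A e) * (k e.1)⁻¹ * (k e.1 * τ e * (k (e.1.shift e.2))⁻¹) := by group
    _ = k e.1 * expChart r.ρ (A e) * (k e.1)⁻¹ * τ e := by rw [hke]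

/-- **Zero modes exponentiate into the stabiliser**: `gaugeExp ζ` fixes `τ` for `ζ ∈ zeroModes τ`. -/
theorem gaugeTransform_gaugeExp_of_mem_zeroModes {τ : GaugeConfig d L G} {ζ : SiteFun r d L} (hζ : ζ ∈ zeroModes r τ) :
    gaugeTransform (gaugeExp r ζ) τ = τ := by
  funext e
  obtain ⟨x, i⟩ := e
  have hz : adFib r (τ (x, i)) (ζ (x.shift i)) = ζ x := by
    have h := (mem_zeroModes_iff r τ ζ).1 hζ i
    simpa using congrArg (fun f : SiteFun r d L => f x) h
  show expChart r.ρ (ζ x) * τ (x, i) * (expChart r.ρ (ζ (x.shift i)))⁻¹ = τ (x, i)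
  rw [← hz, expChart_adFib]
  group

/-- The gauge transformation of a chart point, in matrices: `ρ((h · cfg τ A)(x,i)) = ρ(h x) e^{M A(x,i)} ρ(τ(x,i)) ρ(h(x+e_i))⁻¹`. -/
theorem rho_gaugeTransform_cfg (τ : GaugeConfig d L G) (h : Site d L → G) (A : OneForm r d L) (e : Edge d L) :
    r.ρ (gaugeTransform h (cfg r τ A) e) = r.ρ (h e.1) * exp (lieIso r.ρ (A e)) * r.ρ (τ e) * r.ρ (h (e.1.shift e.2))⁻¹ := by
  show r.ρ (h e.1 * (expChart r.ρ (A e) * τ e) * (h (e.1.shift e.2))⁻¹) = _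
  rw [map_mul, map_mul, map_mul, rho_expChart r.ρ r.continuous]
  simp only [Matrix.mul_assoc]

/-! ### The cross-term identity -/

/-- **Cross-term identity.** Let `α : sites → M_N(ℂ)` be covariantly constant along direction `i` at `τ`
(`α(x) = ρτ(x,i) α(x+e_i) ρτ(x,i)⁻¹`) and along direction `j`. Then for every 1-form `B`,
`Σ_x Re tr(α(x)ᴴ · M((d¹B)_{ij}(x))) = 0`: the four sums cancel in pairs after re-indexing `x ↦ x + e_i` resp. `x ↦ x + e_j`. -/
theorem sum_re_trace_conjTranspose_mul_dOne [NeZero L] (τ : GaugeConfig d L G) {i j : Fin d}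
    (α : Site d L → Matrix (Fin r.N) (Fin r.N) ℂ)
    (hαi : ∀ x, α x = r.ρ (τ (x, i)) * α (x.shift i) * r.ρ (τ (x, i))⁻¹)
    (hαj : ∀ x, α x = r.ρ (τ (x, j)) * α (x.shift j) * r.ρ (τ (x, j))⁻¹) (B : OneForm r d L) :
    ∑ x : Site d L, ((α x)ᴴ * lieIso r.ρ (dOne r τ B i j x)).trace.re = 0 := by
  -- expand `dOne` and distribute
  have hexp : ∀ x, ((α x)ᴴ * lieIso r.ρ (dOne r τ B i j x)).trace.re =
      (((α x)ᴴ * lieIso r.ρ (adFib r (τ (x, i)) (B (x.shift i, j)))).trace.re - ((α x)ᴴ * lieIso r.ρ (B (x, j))).trace.re) -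
      (((α x)ᴴ * lieIso r.ρ (adFib r (τ (x, j)) (B (x.shift j, i)))).trace.re - ((α x)ᴴ * lieIso r.ρ (B (x, i))).trace.re) := by
    intro x
    rw [dOne_apply, map_sub, map_sub, map_sub, Matrix.mul_sub, Matrix.mul_sub, Matrix.mul_sub, Matrix.trace_sub,
      Matrix.trace_sub, Matrix.trace_sub, Complex.sub_re, Complex.sub_re, Complex.sub_re]
  simp only [hexp, Finset.sum_sub_distrib]
  -- the transported sums equal the plain sums after re-indexing
  have hi : ∑ x : Site d L, ((α x)ᴴ * lieIso r.ρ (adFib r (τ (x, i)) (B (x.shift i, j)))).trace.re =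
      ∑ x : Site d L, ((α x)ᴴ * lieIso r.ρ (B (x, j))).trace.re := by
    have hterm : ∀ x, ((α x)ᴴ * lieIso r.ρ (adFib r (τ (x, i)) (B (x.shift i, j)))).trace.re =
        ((α (x.shift i))ᴴ * lieIso r.ρ (B (x.shift i, j))).trace.re := by
      intro x
      rw [lieIso_adFib, hαi x, re_trace_conjTranspose_conj_mul, rho_inv_conj_conj]
    simp only [hterm]
    exact Function.Bijective.sum_comp (Equiv.addRight (Pi.single i (1 : ZMod L) : Site d L)).bijective
      (fun y => ((α y)ᴴ * lieIso r.ρ (B (y, j))).trace.re)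
  have hj : ∑ x : Site d L, ((α x)ᴴ * lieIso r.ρ (adFib r (τ (x, j)) (B (x.shift j, i)))).trace.re =
      ∑ x : Site d L, ((α x)ᴴ * lieIso r.ρ (B (x, i))).trace.re := by
    have hterm : ∀ x, ((α x)ᴴ * lieIso r.ρ (adFib r (τ (x, j)) (B (x.shift j, i)))).trace.re =
        ((α (x.shift j))ᴴ * lieIso r.ρ (B (x.shift j, i))).trace.re := by
      intro x
      rw [lieIso_adFib, hαj x, re_trace_conjTranspose_conj_mul, rho_inv_conj_conj]
    simp only [hterm]
    exact Function.Bijective.sum_comp (Equiv.addRight (Pi.single j (1 : ZMod L) : Site d L)).bijective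
      (fun y => ((α y)ᴴ * lieIso r.ρ (B (y, i))).trace.re)
  rw [hi, hj, sub_self, sub_self, sub_self]

end Summit.QuantumFields.YangMills.Theorems.LocalInsertion.SublevelDoubling

end
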